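import Summits.SmoothPoincare4.SmoothPoincare4.Theses.CongruenceShadows

/-!
# `NilpotentShadowsStandard` — negative-side support: load-bearing hypotheses
# (crux `stmt-SmoothPoincare4-14594`, route `CongruenceShadows`)

Standing-disprover lemmas (refuter, cdisprove cycle 1). Nothing here asserts a Theses statement.

* `nilpotentShadowsStandard_false_without_trisection` — the crux with its hypothesis
  `IsGroupTrisection (3+3m) (m+1) PUnit K` dropped is FALSE (`m = 0`, `c = 0`, junk triple `K = ⊤`):
  the abelian shadow `N₀·γ₂S₃` of the first standard kernel is proper (the character `b₁ ↦ 1 ∈ ℤ`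
  kills it), so no automorphism carries it onto `⊤`. Any proof must use the trisection hypothesis.
* `nilpotentShadowsStandardAnyGroup_false_of_cyclicTrisection` — the crux with the trivial group
  replaced by an arbitrary group is FALSE as soon as a `(3,1)` group trisection of a non-trivial finite
  cyclic group exists (spun lens spaces `𝒮(L(p,q))`, Meier, arXiv:1708.01214 Thm 1.2/§4.1, give them;
  the construction is not in the tree and enters as a hypothesis): `⊔ᵢ Kᵢ·γ₂ ≤ ker(S₃ ↠ ℤ/p)` while
  `⊔ᵢ Nᵢ = ⊤`. So the trivial group is load-bearing already at the abelian level `c = 0`.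
-/

noncomputable section

-- the prescribed namespace `Summit.<P>.<Sub>.…` duplicates `SmoothPoincare4` (P = Sub)
set_option linter.dupNamespace false

namespace Summit.SmoothPoincare4.SmoothPoincare4.Theorems.NilpotentShadowsStandard.Negative

open Literature.Topology.FourManifolds Subgroup
open Summit.SmoothPoincare4.SmoothPoincare4.Theses.CongruenceShadows

/-! ## Automorphisms and the lower central series -/

/-- An automorphism maps `⊤` onto `⊤`. [folklore] -/
theorem map_top_equiv {G : Type*} [Group G] (ψ : G ≃* G) :
    (⊤ : Subgroup G).map ψ.toMonoidHom = ⊤ := by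
  rw [← MonoidHom.range_eq_map, MonoidHom.range_eq_top.2 ψ.surjective]

/-- An automorphism maps each term of the lower central series of `⊤` onto itself. [folklore] -/
theorem map_lcs_top_equiv {G : Type*} [Group G] (ψ : G ≃* G) (n : ℕ) :
    ((⊤ : Subgroup G).lowerCentralSeries n).map ψ.toMonoidHom = (⊤ : Subgroup G).lowerCentralSeries n := by
  rw [Subgroup.map_lowerCentralSeries, map_top_equiv]

/-! ## Load-bearing hypothesis 1: the trisection property -/

/-- The surface relator dies in every commutative group. [folklore] -/
theorem lift_surfaceRelator_eq_one {g : ℕ} {A : Type*} [CommGroup A] (f : surfaceGen g → A) :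
    FreeGroup.lift f (surfaceRelator g) = 1 := by
  unfold surfaceRelator
  rw [map_list_prod, List.map_map]
  apply List.prod_eq_one
  intro x hx
  rw [List.mem_map] at hx
  obtain ⟨i, -, rfl⟩ := hx
  simp [genA, genB, mul_inv_cancel_comm]

/-- Characters of the surface group: every assignment of the generators into a commutative group
extends to a homomorphism taking the prescribed values on generators. [folklore] -/
theorem exists_character {g : ℕ} {A : Type*} [CommGroup A] (f : surfaceGen g → A) :
    ∃ χ : SurfaceGroup g →* A, ∀ x, χ (PresentedGroup.of x) = f x :=
  ⟨PresentedGroup.toGroup (f := f) (by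
      intro r hr
      rw [Set.mem_singleton_iff] at hr
      subst hr
      exact lift_surfaceRelator_eq_one f),
    fun _ => PresentedGroup.toGroup.of _⟩

/-- The abelian shadow of the first standard kernel of genus `3` is proper: `N₀·γ₂S₃ ≠ ⊤`
(`N₀ = ⟪a₁, a₂, b₃⟫` and all commutators die under the character `b₁ ↦ 1 ∈ ℤ`, `b₁` does not).
[folklore] -/
theorem s4Kernels_zero_sup_lcs_one_ne_top :
    s4Kernels 0 ⊔ (⊤ : Subgroup (SurfaceGroup 3)).lowerCentralSeries 1 ≠ ⊤ := by
  obtain ⟨χ, hχ⟩ := exists_character (g := 3) (A := Multiplicative ℤ)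
    fun x => if x = ((0 : Fin 3), true) then Multiplicative.ofAdd 1 else 1
  intro h
  have hN : s4Kernels 0 ≤ χ.ker := by
    rw [s4Kernels_eq]
    refine Subgroup.normalClosure_le_normal ?_
    rintro _ ⟨x, hx, rfl⟩
    rw [SetLike.mem_coe, MonoidHom.mem_ker, hχ]
    have hx' : x ≠ ((0 : Fin 3), true) := by
      rintro rfl
      simp [s4Gens] at hx
    simp [hx']
  have hγ : (⊤ : Subgroup (SurfaceGroup 3)).lowerCentralSeries 1 ≤ χ.ker := by
    rw [Subgroup.top_lowerCentralSeries_one]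
    exact Abelianization.commutator_subset_ker _
  have hle := sup_le hN hγ
  rw [h, top_le_iff] at hle
  have hb : χ (SurfaceGroup.b (0 : Fin 3)) = 1 := by
    rw [← MonoidHom.mem_ker, hle]; exact Subgroup.mem_top _
  rw [SurfaceGroup.b, hχ] at hb
  simp at hb

/-- ANY PROOF MUST USE THE TRISECTION HYPOTHESIS: the crux with `IsGroupTrisection (3+3m) (m+1) PUnit K`
dropped fails at `m = 0`, `c = 0` on the junk triple `K = ⊤`. [folklore] -/
theorem nilpotentShadowsStandard_false_without_trisection :
    ¬ ∀ (m : ℕ) (K : TrisectionKernels (3 + 3 * m)) (c : ℕ),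
        ∃ ψ : SurfaceGroup (3 + 3 * m) ≃* SurfaceGroup (3 + 3 * m), ∀ i : Fin 3,
          (s4Kernels.stabilizeIter m i ⊔
              (⊤ : Subgroup (SurfaceGroup (3 + 3 * m))).lowerCentralSeries (c + 1)).map ψ.toMonoidHom =
            K i ⊔ (⊤ : Subgroup (SurfaceGroup (3 + 3 * m))).lowerCentralSeries (c + 1) := by
  intro h
  obtain ⟨ψ, hψ⟩ := h 0 (fun _ => ⊤) 0
  have h0 : (s4Kernels.stabilizeIter 0 0 ⊔
      (⊤ : Subgroup (SurfaceGroup (3 + 3 * 0))).lowerCentralSeries (0 + 1)).map ψ.toMonoidHom =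
      (⊤ : Subgroup (SurfaceGroup (3 + 3 * 0))).map ψ.toMonoidHom := by
    rw [hψ 0, top_sup_eq, map_top_equiv]
  exact s4Kernels_zero_sup_lcs_one_ne_top (Subgroup.map_injective ψ.injective h0)

/-! ## Load-bearing hypothesis 2: the trivial group -/

/-- The three standard kernels of genus `3` generate: `N₀ ⊔ N₁ ⊔ N₂ = ⊤` (each generator is killed by
some kernel). [folklore] -/
theorem s4Kernels_sup_eq_top : s4Kernels 0 ⊔ s4Kernels 1 ⊔ s4Kernels 2 = ⊤ := by
  rw [eq_top_iff, ← PresentedGroup.closure_range_of, Subgroup.closure_le]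
  rintro _ ⟨x, rfl⟩
  obtain ⟨i, hi⟩ := s4Gens_cover x
  have hmem := of_mem_s4Kernels i hi
  fin_cases i
  · exact Subgroup.mem_sup_left (Subgroup.mem_sup_left hmem)
  · exact Subgroup.mem_sup_left (Subgroup.mem_sup_right hmem)
  · exact Subgroup.mem_sup_right hmem

/-- THE TRIVIAL GROUP IS LOAD-BEARING ALREADY AT THE ABELIAN LEVEL: if some `(3,1)` group trisection
of a non-trivial finite cyclic group exists (the spun lens spaces `𝒮(L(p,q))` carry `(3,1)`
trisections with `π₁ = ℤ/p` — Meier, *Trisections and spun 4-manifolds*, Thm 1.2 and §4.1 — whose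
group trisections, AGK Thm 5, are such; the construction is not in the tree and is taken as a
hypothesis), then the any-group form of the crux fails at `m = 0`, `c = 0`: the images `Kᵢ·γ₂` all lie
in the kernel of `S₃ ↠ ℤ/p`, whereas `⊔ᵢ Nᵢ = ⊤`. [cite: Meier2017, Thm 1.2] -/
theorem nilpotentShadowsStandardAnyGroup_false_of_cyclicTrisection
    (hex : ∃ (p : ℕ) (K : TrisectionKernels 3), 1 < p ∧
      IsGroupTrisection 3 1 (Multiplicative (ZMod p)) K) :
    ¬ ∀ (m : ℕ) (G : Type) [Group G] (K : TrisectionKernels (3 + 3 * m)),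
        IsGroupTrisection (3 + 3 * m) (m + 1) G K → ∀ c : ℕ,
          ∃ ψ : SurfaceGroup (3 + 3 * m) ≃* SurfaceGroup (3 + 3 * m), ∀ i : Fin 3,
            (s4Kernels.stabilizeIter m i ⊔
                (⊤ : Subgroup (SurfaceGroup (3 + 3 * m))).lowerCentralSeries (c + 1)).map ψ.toMonoidHom =
              K i ⊔ (⊤ : Subgroup (SurfaceGroup (3 + 3 * m))).lowerCentralSeries (c + 1) := by
  obtain ⟨p, K, hp, hK⟩ := hex
  intro h
  haveI : Fact (1 < p) := ⟨hp⟩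
  obtain ⟨ψ, hψ⟩ := h 0 (Multiplicative (ZMod p)) K hK 0
  obtain ⟨e⟩ := hK.triple
  -- the surjection `S₃ ↠ ℤ/p` through the triple quotient
  set φ : SurfaceGroup 3 →* Multiplicative (ZMod p) := e.toMonoidHom.comp (QuotientGroup.mk' _) with hφ
  have hφK : ∀ i, K i ≤ φ.ker := by
    intro i x hx
    have hxU : x ∈ ⋃ j, (K j : Set (SurfaceGroup 3)) := Set.mem_iUnion.2 ⟨i, hx⟩
    rw [MonoidHom.mem_ker]
    change e (QuotientGroup.mk' _ x) = 1
    rw [QuotientGroup.mk'_apply, (QuotientGroup.eq_one_iff x).2 (Subgroup.subset_normalClosure hxU),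
      map_one]
  have hφγ : (⊤ : Subgroup (SurfaceGroup 3)).lowerCentralSeries 1 ≤ φ.ker := by
    rw [Subgroup.top_lowerCentralSeries_one]
    exact Abelianization.commutator_subset_ker _
  have hall : ∀ i, K i ⊔ (⊤ : Subgroup (SurfaceGroup 3)).lowerCentralSeries 1 ≤ φ.ker :=
    fun i => sup_le (hφK i) hφγ
  -- transport `⊤ = ⊔ᵢ Nᵢγ₂` through `ψ`
  have htop : (⊤ : Subgroup (SurfaceGroup 3)) ≤ φ.ker := by
    have h3 : (s4Kernels 0 ⊔ (⊤ : Subgroup (SurfaceGroup 3)).lowerCentralSeries 1) ⊔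
        (s4Kernels 1 ⊔ (⊤ : Subgroup (SurfaceGroup 3)).lowerCentralSeries 1) ⊔
        (s4Kernels 2 ⊔ (⊤ : Subgroup (SurfaceGroup 3)).lowerCentralSeries 1) = ⊤ := by
      rw [eq_top_iff, ← s4Kernels_sup_eq_top]
      exact sup_le (sup_le (le_sup_left.trans (le_sup_left.trans le_sup_left))
        (le_sup_left.trans (le_sup_right.trans le_sup_left))) (le_sup_left.trans le_sup_right)
    have := congrArg (Subgroup.map ψ.toMonoidHom) h3
    rw [map_top_equiv, Subgroup.map_sup, Subgroup.map_sup] at this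
    rw [← this]
    exact sup_le (sup_le ((hψ 0).le.trans (hall 0)) ((hψ 1).le.trans (hall 1)))
      ((hψ 2).le.trans (hall 2))
  -- but `φ` is onto a non-trivial group
  obtain ⟨x, hx⟩ : ∃ x, φ x = Multiplicative.ofAdd 1 :=
    (e.surjective.comp (QuotientGroup.mk'_surjective _)) _
  have hx1 : φ x = 1 := (MonoidHom.mem_ker).1 (htop (Subgroup.mem_top x))
  rw [hx1] at hx
  have h10 : (1 : ZMod p) = 0 := by
    have := congrArg Multiplicative.toAdd hx
    simpa using this.symm
  exact one_ne_zero h10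

end Summit.SmoothPoincare4.SmoothPoincare4.Theorems.NilpotentShadowsStandard.Negative

end
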